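import Summits.ResolutionOfSingularities.ResolutionOfSingularities.Theorems.FrobeniusClosingPatchingRelPerfectConeCubeDepthIdeals
import Summits.ResolutionOfSingularities.ResolutionOfSingularities.Theorems.FrobeniusClosingPatchingRelPerfectConeCubeLevelTwo
import HarnessLib

/-!
# Crux `PatchingRelPerfect` (stmt-ResolutionOfSingularities-16161), chain w52 — the contact-migration
# member at EVERY depth `ℓ`: level two (the vertex blow-up), regularity

[OURS · L1 W5.2 · rung] Generalises `…ConeCubeLevelTwo` (`ℓ = 2`, five-step tower) to the path of
`n` nodes of `…ConeCubeDepthIdeals` (`n = 3ℓ - 1` for depth `ℓ`).  The hypotheses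
`H''(C_k; c, w, G)` of the letter tower do not depend on the depth, so the SAME discharge
(`…ConeCubeLevelTwo`, brick 7 `…ChartStrictHypersurface`) gives, for every `n`:

* `isDomain_quot_span_c_G`, `isRegularRing_quot_span_c_G`, `w_notMem_span_c_G` — the three
  hypotheses about the centre `(c, G) = (u', G)`, as standalone lemmas;
* `isRegular_of_isBlowup_cFlag` — every blowing up of `Spec C_k` along ANY flag
  `∏_{s<N} (c, L₀⋯L_s)` with letters in `{w, G, 1}` is regular (`isRegular_of_isBlowup_letterTower N`);
* `isRegular_of_isBlowup_cmPi_succ` — the `v_k`-chart: `Π_n C_k = (w)ⁿ · (flag of w G w w G …)`;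
  `_zero` — the `t`-chart;
* `isRegular_of_isBlowup_cmPi_mul_span` — **every blowing up of `Spec A` along `Π_n · (t, v₀, v₁, v₂)`
  is regular**.

Nothing here is a statement of the manuscript under review.

## References

* The Stacks Project, Tags 080A, 080B, 0804, 0BIQ. [StacksProject]
* Q. Liu, *Algebraic Geometry and Arithmetic Curves*, OUP 2002, Thm. 8.1.19 (a). [Liu2002]
* H. Matsumura, *Commutative Ring Theory*, CUP 1986, Thm. 16.2. [Matsumura1987]
-/

-- `Summit.<Summit>.<Sub>.Theorems` with `Sub = Summit` (single-conjunct summit, D-0017)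
set_option linter.dupNamespace false

noncomputable section

open CategoryTheory CategoryTheory.Limits AlgebraicGeometry Literature.AlgebraicGeometry.Resolution
open IsLocalRing

namespace Summit.ResolutionOfSingularities.ResolutionOfSingularities.Theorems

namespace ConeRung

universe u

section LevelTwoRegular

variable {A : Type u} [CommRing A] (t : A) (v : Fin 3 → A)
  (hc : IsQuasiRegular (Fin.cons t v : Fin 4 → A))

local notation3 "cc" => (Fin.cons t v : Fin 4 → A)
local notation3 "F" => v 0 * v 1 + v 2 ^ 2
/-- the companion path `Π_n = ∏_{s<n} ((z) + (t)^{(s+2)/3} N^{(s+2)%3})` at the vertex chart -/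
local notation3 "cmPi[" n "]" => ∏ s ∈ Finset.range n,
  (Ideal.span {v 0 * v 1 + v 2 ^ 2 + t} ⊔
    Ideal.span {t} ^ ((s + 2) / 3) * Ideal.span {t, v 0, v 1, v 2} ^ ((s + 2) % 3))
/-- the `v_k`-chart (`j = k + 1`) and its data -/
local notation3 "C[" k "]" => chartRing (Fin.cons t v : Fin 4 → A) (Fin.succ k)
local notation3 "w[" k "]" => chartBase cc (Fin.succ k) (cc (Fin.succ k))
local notation3 "u'[" k "]" => chartGen cc (Fin.succ k) 0
local notation3 "G[" k "]" => chartGen cc (Fin.succ k) 1 * chartGen cc (Fin.succ k) 2 +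
  chartGen cc (Fin.succ k) 3 ^ 2
/-- the strict transform `c = u' + w G` of `V(F + t)` on the `v_k`-chart -/
local notation3 "c[" k "]" => chartGen cc (Fin.succ k) 0 +
  chartBase cc (Fin.succ k) (cc (Fin.succ k)) *
    (chartGen cc (Fin.succ k) 1 * chartGen cc (Fin.succ k) 2 + chartGen cc (Fin.succ k) 3 ^ 2)

variable [IsDomain A]

omit [IsDomain A] in
include hc in
/-- `C_k ⧸ (c, G)` is a domain (`= C_k ⧸ (u', G)`, brick 7). [cite: StacksProject, Tag 0BIQ] -/
theorem isDomain_quot_span_c_G (k : Fin 3) [IsDomain (A ⧸ Ideal.span (Set.range cc))]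
    [IsDomain (A ⧸ Ideal.span {t})] (hdF : IsDomain (A ⧸ Ideal.span {t, v 0 * v 1 + v 2 ^ 2}))
    (hvk : v k ∉ Ideal.span {t}) (hvkF : v k ∉ Ideal.span {t, v 0 * v 1 + v 2 ^ 2}) :
    IsDomain (C[k] ⧸ Ideal.span {c[k], G[k]}) := by
  haveI := hdF
  rw [span_c_G t v k]
  exact strictHyp_isDomain_quot_pair t v k hc hvk (chartBase_F_two t v (Fin.succ k))
    (G_notMem_sup t v hc k) hvkF

omit [IsDomain A] in
include hc in
/-- `C_k ⧸ (c, G)` is a regular ring (`= C_k ⧸ (u', G)`, r2c). [cite: Matsumura1987, Thm. 14.2] -/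
theorem isRegularRing_quot_span_c_G (k : Fin 3) [IsRegularRing A]
    [IsDomain (A ⧸ Ideal.span (Set.range cc))] [IsRegularRing (A ⧸ Ideal.span (Set.range cc))]
    (hreg1 : ∀ (P : Ideal (A ⧸ Ideal.span {t, F})) [P.IsPrime],
      Ideal.Quotient.mk (Ideal.span {t, F}) (v k) ∉ P → IsRegularLocalRing (Localization.AtPrime P)) :
    IsRegularRing (C[k] ⧸ Ideal.span {c[k], G[k]}) := by
  rw [span_c_G t v k]
  exact isRegularRing_quot_span_u'_G t v hc k hreg1

omit [IsDomain A] in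
include hc in
/-- `w ∉ (c, G)` (brick 7). [folklore] -/
theorem w_notMem_span_c_G (k : Fin 3) [IsDomain (A ⧸ Ideal.span (Set.range cc))]
    [IsDomain (A ⧸ Ideal.span {t})] (hdF : IsDomain (A ⧸ Ideal.span {t, v 0 * v 1 + v 2 ^ 2}))
    (hvk : v k ∉ Ideal.span {t}) (hvkF : v k ∉ Ideal.span {t, v 0 * v 1 + v 2 ^ 2}) :
    w[k] ∉ Ideal.span {c[k], G[k]} := by
  haveI := hdF
  rw [span_c_G t v k]
  exact strictHyp_chartBase_notMem_pair t v k hc hvk (chartBase_F_two t v (Fin.succ k))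
    (G_notMem_sup t v hc k) hvkF

include hc in
/-- **The letter tower on the `v_k`-chart for ANY word in `{w, G, 1}`**: `H''(C_k; c, w, G)` is
discharged exactly as at depth two (`…ConeCubeLevelTwo`, brick 7), so every blowing up of
`Spec C_k` along a flag `∏_{s<N} (c, L₀⋯L_s)` is regular. [cite: StacksProject, Tag 080A]
[cite: Liu2002, Thm. 8.1.19 (a)] [cite: Matsumura1987, Thm. 16.2] -/
theorem isRegular_of_isBlowup_cFlag (N : ℕ) (k : Fin 3) [IsRegularRing A]
    [IsDomain (A ⧸ Ideal.span (Set.range cc))] [IsRegularRing (A ⧸ Ideal.span (Set.range cc))]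
    [IsDomain (A ⧸ Ideal.span {t})] (hdF : IsDomain (A ⧸ Ideal.span {t, v 0 * v 1 + v 2 ^ 2}))
    (hvk : v k ∉ Ideal.span {t}) (hFt : F ∉ Ideal.span {t})
    (hvkF : v k ∉ Ideal.span {t, v 0 * v 1 + v 2 ^ 2})
    (hreg1 : ∀ (P : Ideal (A ⧸ Ideal.span {t, F})) [P.IsPrime],
      Ideal.Quotient.mk (Ideal.span {t, F}) (v k) ∉ P → IsRegularLocalRing (Localization.AtPrime P))
    (L : ℕ → C[k]) (hL : ∀ r, L r = w[k] ∨ L r = G[k] ∨ L r = 1)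
    {Y : Scheme.{u}} {ρ : Y ⟶ Spec (.of C[k])}
    (hρ : IsBlowup ρ (affineBlowup.idealSheaf (∏ s ∈ Finset.range N,
      Ideal.span {c[k], ∏ r ∈ Finset.range (s + 1), L r}))) :
    Scheme.IsRegular Y := by
  haveI : IsRegularRing C[k] := isRegularRing_blowupChart cc (Fin.succ k) hc
  haveI : IsDomain C[k] := strictExc_isDomain_chart t v k (strictExc_ne_zero t v k hvk)
  have hcw := isWeaklyRegular_c_w t v hc k hvk
  have hcG := isWeaklyRegular_c_G t v hc k hvk hFt
  exact isRegular_of_isBlowup_letterTower N c[k] w[k] G[k] L hL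
    (isQuasiRegular_of_isWeaklyRegular _ hcw) (isQuasiRegular_of_isWeaklyRegular _ hcG)
    (isDomain_quot_span_c_w t v hc k) (isRegularRing_quot_span_c_w t v hc k)
    (isDomain_quot_span_c_G t v hc k hdF hvk hvkF) (isRegularRing_quot_span_c_G t v hc k hreg1)
    ((isWeaklyRegular_pair_iff _ _).mp hcw).2 ((isWeaklyRegular_pair_iff _ _).mp hcG).2
    (nonZeroDivisors.ne_zero (w_mem_nonZeroDivisors t v k)) (G_notMem_span_c_w t v hc k)
    (w_notMem_span_c_G t v hc k hdF hvk hvkF) hρ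

include hc in
/-- **The `v_k`-chart of `Bl_{z₀}`, any number of nodes**: every blowing up of `Spec C_k` along
`Π_n C_k = (w)ⁿ · ∏_{s<n} (c, L₀⋯L_s)` is regular — twist off `wⁿ` and run the letter tower of
the word `w G w w G …`. [cite: StacksProject, Tag 080B] [cite: Liu2002, Thm. 8.1.19 (a)] -/
theorem isRegular_of_isBlowup_cmPi_succ (n : ℕ) (k : Fin 3) [IsRegularRing A]
    [IsDomain (A ⧸ Ideal.span (Set.range cc))] [IsRegularRing (A ⧸ Ideal.span (Set.range cc))]
    [IsDomain (A ⧸ Ideal.span {t})] (hdF : IsDomain (A ⧸ Ideal.span {t, v 0 * v 1 + v 2 ^ 2}))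
    (hvk : v k ∉ Ideal.span {t}) (hFt : F ∉ Ideal.span {t})
    (hvkF : v k ∉ Ideal.span {t, v 0 * v 1 + v 2 ^ 2})
    (hreg1 : ∀ (P : Ideal (A ⧸ Ideal.span {t, F})) [P.IsPrime],
      Ideal.Quotient.mk (Ideal.span {t, F}) (v k) ∉ P → IsRegularLocalRing (Localization.AtPrime P))
    {Y : Scheme.{u}} {ρ : Y ⟶ Spec (.of C[k])}
    (hρ : IsBlowup ρ (affineBlowup.idealSheaf ((cmPi[n]).map (chartBase cc (Fin.succ k))))) :
    Scheme.IsRegular Y := by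
  have hwn : w[k] ^ n ∈ nonZeroDivisors C[k] := pow_mem (w_mem_nonZeroDivisors t v k) n
  rw [map_chartBase_cmPi t v (Fin.succ k) n, Ideal.span_singleton_pow] at hρ
  exact CoreRungTower.isRegular_of_isBlowup_span_singleton_mul hwn _
    (fun Y' ρ' h' => isRegular_of_isBlowup_cFlag t v hc n k hdF hvk hFt hvkF hreg1
      (fun r => if r % 3 = 1 then G[k] else w[k]) (cmLetters_spec w[k] G[k]) h') hρ

omit [IsDomain A] in
include hc in
/-- **The `t`-chart of `Bl_{z₀}`**: every blowing up of `Spec C₀` along `Π_n C₀ = (w)ⁿ` is regular.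
[cite: Liu2002, Thm. 8.1.19 (a) (affine charts)] -/
theorem isRegular_of_isBlowup_cmPi_zero (n : ℕ) [IsRegularRing A]
    [IsRegularRing (A ⧸ Ideal.span (Set.range cc))]
    {Y : Scheme.{u}} {ρ : Y ⟶ Spec (.of (chartRing cc 0))}
    (hρ : IsBlowup ρ (affineBlowup.idealSheaf ((cmPi[n]).map (chartBase cc 0)))) :
    Scheme.IsRegular Y := by
  haveI : IsRegularRing (chartRing cc 0) := isRegularRing_blowupChart cc 0 hc
  rw [map_chartBase_cmPi_zero, Ideal.span_singleton_pow] at hρ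
  exact isRegular_of_isBlowup_idealSheaf_span_singleton_of_isRegularRing
    (pow_mem (reesChartBase_mem_nonZeroDivisors (cc 0)
      (Ideal.mem_span_range_self (f := cc) (x := 0))) n) hρ

include hc in
/-- **LEVEL TWO, any number of nodes: every blowing up of `Spec A` along `Π_n · (t, v₀, v₁, v₂)` is
regular.** [cite: StacksProject, Tag 080A] [cite: Liu2002, Thm. 8.1.19 (a)] -/
theorem isRegular_of_isBlowup_cmPi_mul_span (n : ℕ) [IsRegularRing A]
    [IsDomain (A ⧸ Ideal.span (Set.range cc))] [IsRegularRing (A ⧸ Ideal.span (Set.range cc))]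
    [IsDomain (A ⧸ Ideal.span {t})] (hdF : IsDomain (A ⧸ Ideal.span {t, v 0 * v 1 + v 2 ^ 2}))
    (hv : ∀ k, v k ∉ Ideal.span {t}) (hFt : F ∉ Ideal.span {t})
    (hvF : ∀ k, v k ∉ Ideal.span {t, v 0 * v 1 + v 2 ^ 2})
    (hreg1 : ∀ (k : Fin 3) (P : Ideal (A ⧸ Ideal.span {t, F})) [P.IsPrime],
      Ideal.Quotient.mk (Ideal.span {t, F}) (v k) ∉ P → IsRegularLocalRing (Localization.AtPrime P))
    {Y : Scheme.{u}} {f : Y ⟶ Spec (.of A)}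
    (hf : IsBlowup f (affineBlowup.idealSheaf ((cmPi[n]) * Ideal.span {t, v 0, v 1, v 2}))) :
    Scheme.IsRegular Y := by
  have e : (cmPi[n]) * Ideal.span {t, v 0, v 1, v 2} = (cmPi[n]) * Ideal.span (Set.range cc) :=
    congrArg _ (span_t_v_eq t v)
  rw [e] at hf
  exact isRegular_of_isBlowup_mul_of_charts cc _
    (fun j => Fin.cases
      (motive := fun j => ∀ (Y : Scheme.{u}) (ρ : Y ⟶ Spec (.of (chartRing cc j))),
        IsBlowup ρ (affineBlowup.idealSheaf ((cmPi[n]).map (chartBase cc j))) →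
          Scheme.IsRegular Y)
      (fun _ _ h => isRegular_of_isBlowup_cmPi_zero t v hc n h)
      (fun k _ _ h => isRegular_of_isBlowup_cmPi_succ t v hc n k hdF (hv k) hFt (hvF k) (hreg1 k) h)
      j)
    hf

end LevelTwoRegular

end ConeRung

end Summit.ResolutionOfSingularities.ResolutionOfSingularities.Theorems

end
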